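import Mathlib.LinearAlgebra.ExteriorPower.Basis
import Mathlib.GroupTheory.Perm.Fin
import Mathlib.Order.Interval.Finset.Fin
import Mathlib.Data.Int.Order.Units
import Literature.AlgebraicGeometry.Crystalline.KaehlerDeRhamComplex
import HarnessLib

/-!
# Left wedge by a one-vector on the increasing exterior products `v_{s₁} ∧ ⋯ ∧ v_{sₙ}`

For a commutative ring `R`, an `R`-module `M`, a linearly ordered index type `I`, a family
`v : I → M` and a finite set `s = {s₁ < ⋯ < sₙ} ⊆ I`, Mathlib's
`exteriorPower.ιMulti_family R n v s = v_{s₁} ∧ ⋯ ∧ v_{sₙ} ∈ ⋀ⁿ M` is the increasing product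
(`s : Set.powersetCard I n`, the finsets of cardinality `n`). This file computes the left wedge
`ιMul n (v i) : ⋀ⁿ M → ⋀ⁿ⁺¹ M`, `x ↦ v i ∧ x` (`Crystalline/KaehlerDeRhamComplex`) on these
products:

* `ιMul_ιMulti_family_of_not_mem`: for `i ∉ s`,
  `v i ∧ (v_{s₁} ∧ ⋯ ∧ v_{sₙ}) = (-1)^k • (increasing product over insert i s)`, where
  `k = #{j ∈ s | j < i}` is the number of factors `v i` has to move past
  (`insertSign s i = (-1)^k ∈ ℤˣ`);
* `ιMul_ιMulti_family_of_mem`: for `i ∈ s` the product has a repeated factor and vanishes;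
* the bookkeeping identities `insertSign_mul_self` (`ε² = 1`) and `insertSign_anticomm`
  (`ε(s,j) ε(s ∪ j, i) = - ε(s,i) ε(s ∪ i, j)` for `i ≠ j ∉ s`, the sign identity behind `d ∘ d = 0`
  / anticommutation of two insertions);
* the underlying combinatorics of ranks in a finite subset of a linear order:
  `card_filter_lt_orderEmbOfFin_eq_val` (the `j`-th smallest element of `t` has exactly `j`
  elements of `t` below it), `orderEmbOfFin_insert_apply_of_val_eq` and
  `orderEmbOfFin_insert_succAbove` (the increasing enumeration of `insert i s` is that of `s` with
  `i` inserted in position `k`).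

These are helpers for the Cartier-isomorphism computations on the Kähler–de Rham complex (the
exterior derivative and the Cartier operator are computed on the basis `dt_{s₁} ∧ ⋯ ∧ dt_{sₙ}` of
`⋀ⁿ Ω`). Everything is standard multilinear algebra. [folklore]
Mathlib (pin v4.32) has the product formula in the exterior algebra
`ExteriorAlgebra.ιMulti_family_mul_of_disjoint` (degree `m + n`, sign of an abstract sorting
permutation `Set.powersetCard.permOfDisjoint`); the present file gives the case `m = 1` landing in
degree `n + 1` with the explicit sign, via `Fin.cycleRange` (`Fin.sign_cycleRange`) instead.
NOT here: right wedges, the general `(m, n)` sign, interior products.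
-/

noncomputable section

namespace Literature.AlgebraicGeometry.Crystalline

universe u v w

/-! ### Ranks in a finite subset of a linear order -/

section Rank

variable {α : Type w} [LinearOrder α]

/-- The `j`-th smallest element of a finite set `t` (i.e. `t.orderEmbOfFin h j`) has exactly `j`
elements of `t` strictly below it. [folklore] -/
theorem card_filter_lt_orderEmbOfFin_eq_val (t : Finset α) {m : ℕ} (h : t.card = m) (j : Fin m) :
    (t.filter (· < t.orderEmbOfFin h j)).card = (j : ℕ) := by
  have : t.filter (· < t.orderEmbOfFin h j) =
      (Finset.Iio j).map (t.orderEmbOfFin h).toEmbedding := by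
    ext x
    simp only [Finset.mem_filter, Finset.mem_map, Finset.mem_Iio, RelEmbedding.coe_toEmbedding]
    constructor
    · rintro ⟨hx, hlt⟩
      obtain ⟨l, rfl⟩ : x ∈ Set.range (t.orderEmbOfFin h) := by
        rw [Finset.range_orderEmbOfFin]; exact hx
      exact ⟨l, (t.orderEmbOfFin h).lt_iff_lt.1 hlt, rfl⟩
    · rintro ⟨l, hl, rfl⟩
      exact ⟨Finset.orderEmbOfFin_mem _ _ _, (t.orderEmbOfFin h).lt_iff_lt.2 hl⟩
  rw [this, Finset.card_map, Fin.card_Iio]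

/-- An element `x ∈ t` with exactly `j` elements of `t` strictly below it is the `j`-th smallest
element of `t`. [folklore] -/
theorem orderEmbOfFin_eq_of_mem_of_card_filter_lt (t : Finset α) {m : ℕ} (h : t.card = m)
    (j : Fin m) {x : α} (hx : x ∈ t) (hj : (t.filter (· < x)).card = (j : ℕ)) :
    t.orderEmbOfFin h j = x := by
  obtain ⟨l, rfl⟩ : x ∈ Set.range (t.orderEmbOfFin h) := by
    rw [Finset.range_orderEmbOfFin]; exact hx
  rw [card_filter_lt_orderEmbOfFin_eq_val] at hj
  rw [Fin.ext hj]

variable {s : Finset α} {i : α}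

/-- In the increasing enumeration of `insert i s`, the element in position `k = #{y ∈ s | y < i}`
is `i` (whether or not `i ∈ s`). [folklore] -/
theorem orderEmbOfFin_insert_apply_of_val_eq {m : ℕ} (h' : (insert i s).card = m) (k : Fin m)
    (hk : (k : ℕ) = (s.filter (· < i)).card) : (insert i s).orderEmbOfFin h' k = i := by
  apply orderEmbOfFin_eq_of_mem_of_card_filter_lt _ h' k (Finset.mem_insert_self i s)
  rw [Finset.filter_insert, if_neg (lt_irrefl i), hk]

/-- Inserting `i ∉ s` into `s` (`i ∉ s` being encoded by the cardinalities `#s = n`,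
`#(insert i s) = n + 1`): off position `k = #{y ∈ s | y < i}`, the increasing enumeration of
`insert i s` is that of `s` (precomposed with `Fin.succAbove k`). [folklore] -/
theorem orderEmbOfFin_insert_succAbove {n : ℕ} (h : s.card = n)
    (h' : (insert i s).card = n + 1) (k : Fin (n + 1)) (hk : (k : ℕ) = (s.filter (· < i)).card)
    (j : Fin n) : (insert i s).orderEmbOfFin h' (k.succAbove j) = s.orderEmbOfFin h j := by
  have hki := orderEmbOfFin_insert_apply_of_val_eq h' k hk
  have hfs : ∀ x, (insert i s).orderEmbOfFin h' (k.succAbove x) ∈ s := fun x => by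
    rcases Finset.mem_insert.1 (Finset.orderEmbOfFin_mem (insert i s) h' (k.succAbove x)) with
      hx | hx
    · exact absurd (((insert i s).orderEmbOfFin h').injective (hx.trans hki.symm))
        (Fin.succAbove_ne k x)
    · exact hx
  have hmono : StrictMono fun x => (insert i s).orderEmbOfFin h' (k.succAbove x) :=
    ((insert i s).orderEmbOfFin h').strictMono.comp (Fin.strictMono_succAbove k)
  exact congr_fun (Finset.orderEmbOfFin_unique h hfs hmono) j

/-- Inserting `i ∉ s` into `s` (`#s = n`, `#(insert i s) = n + 1`): the increasing enumeration of
`insert i s` is that of `s` with `i` inserted in position `k = #{y ∈ s | y < i}`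
(`Fin.insertNth k i`). [folklore] -/
theorem coe_orderEmbOfFin_insert {n : ℕ} (h : s.card = n) (h' : (insert i s).card = n + 1)
    (k : Fin (n + 1)) (hk : (k : ℕ) = (s.filter (· < i)).card) :
    ⇑((insert i s).orderEmbOfFin h') = Fin.insertNth k i ⇑(s.orderEmbOfFin h) := by
  symm
  refine Fin.insertNth_eq_iff.2 ⟨(orderEmbOfFin_insert_apply_of_val_eq h' k hk).symm, ?_⟩
  funext j
  exact (orderEmbOfFin_insert_succAbove h h' k hk j).symm

end Rank

/-! ### The insertion sign -/

section Sign

variable {I : Type w} [LinearOrder I]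

/-- The sign `ε(s, i) = (-1) ^ #{j ∈ s | j < i} ∈ ℤˣ` picked up when the factor indexed by `i` is
moved from the front of the increasing product over `s` to its sorted position (past the
`#{j ∈ s | j < i}` smaller factors). [folklore] -/
def insertSign (s : Finset I) (i : I) : ℤˣ :=
  (-1) ^ (s.filter (· < i)).card

/-- `ε(s, i) = (-1) ^ #{j ∈ s | j < i}` as an integer. [folklore] -/
theorem coe_insertSign (s : Finset I) (i : I) :
    ((insertSign s i : ℤˣ) : ℤ) = (-1) ^ (s.filter (· < i)).card :=
  rfl

/-- `ε(s, i)² = 1`. [folklore] -/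
theorem insertSign_mul_self (s : Finset I) (i : I) : insertSign s i * insertSign s i = 1 :=
  Int.units_mul_self _

/-- `ε(insert j s, i) = ε(s, i)` if `i < j` (the new element is not below `i`). [folklore] -/
theorem insertSign_insert_of_lt (s : Finset I) {i j : I} (hij : i < j) :
    insertSign (insert j s) i = insertSign s i := by
  unfold insertSign
  rw [Finset.filter_insert, if_neg (not_lt.2 hij.le)]

/-- `ε(insert i s, j) = - ε(s, j)` if `i < j` and `i ∉ s` (one more element below `j`).
[folklore] -/
theorem insertSign_insert_of_lt_of_notMem (s : Finset I) {i j : I} (hij : i < j) (hi : i ∉ s) :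
    insertSign (insert i s) j = -insertSign s j := by
  have hi' : i ∉ s.filter (· < j) := fun h => hi (Finset.mem_filter.1 h).1
  apply Units.val_injective
  rw [Units.val_neg, coe_insertSign, coe_insertSign, Finset.filter_insert, if_pos hij,
    Finset.card_insert_of_notMem hi', pow_succ, mul_neg_one]

/-- **Two successive insertions anticommute**: for `i ≠ j` both outside `s`,
`ε(s, j) ε(insert j s, i) = - ε(s, i) ε(insert i s, j)` — the sign identity making
`v i ∧ (v j ∧ x) = - v j ∧ (v i ∧ x)` consistent on increasing products, and behind `d ∘ d = 0`
for Čech/Koszul-type differentials. [folklore] -/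
theorem insertSign_anticomm {s : Finset I} {i j : I} (hi : i ∉ s) (hj : j ∉ s) (hij : i ≠ j) :
    insertSign s j * insertSign (insert j s) i = -(insertSign s i * insertSign (insert i s) j) := by
  wlog h : i < j generalizing i j
  · have h' : j < i := lt_of_le_of_ne (not_lt.1 h) hij.symm
    rw [this hj hi hij.symm h', neg_neg]
  rw [insertSign_insert_of_lt s h, insertSign_insert_of_lt_of_notMem s h hi, mul_neg, neg_neg,
    mul_comm]

end Sign

/-! ### Left wedge by `v i` on the increasing products -/

section Wedge

variable {R : Type u} [CommRing R] {M : Type v} [AddCommGroup M] [Module R M]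
  {I : Type w} [LinearOrder I]

/-- The integer sign `ε(s, i)` acts on an `R`-module as the ring element
`(-1 : R) ^ #{j ∈ s | j < i}`. [folklore] -/
theorem coe_insertSign_smul {N : Type*} [AddCommGroup N] [Module R N]
    (s : Finset I) (i : I) (x : N) :
    ((insertSign s i : ℤˣ) : ℤ) • x = ((-1 : R) ^ (s.filter (· < i)).card) • x := by
  rw [coe_insertSign, ← Int.cast_smul_eq_zsmul R, Int.cast_pow, Int.cast_neg, Int.cast_one]

/-- **Insertion into an increasing product not containing the new index.** For `i ∉ s`,
`v i ∧ (v_{s₁} ∧ ⋯ ∧ v_{sₙ}) = (-1)^{#{j ∈ s | j < i}} • v_{t₁} ∧ ⋯ ∧ v_{tₙ₊₁}` where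
`t = insert i s` enumerated increasingly: moving `v i` past the `k = #{j ∈ s | j < i}` smaller
factors is the cycle `Fin.cycleRange k`, of sign `(-1)^k`. [folklore] -/
theorem ιMul_ιMulti_family_of_not_mem {n : ℕ} (v : I → M) (s : Set.powersetCard I n) (i : I)
    (hi : i ∉ (s : Finset I)) :
    ιMul n (v i) (exteriorPower.ιMulti_family R n v s) =
      ((insertSign (s : Finset I) i : ℤˣ) : ℤ) •
        exteriorPower.ιMulti_family R (n + 1) v
          ⟨insert i (s : Finset I), Set.powersetCard.mem_iff.mpr
            (by rw [Finset.card_insert_of_notMem hi, Set.powersetCard.card_eq])⟩ := by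
  have hs : (s : Finset I).card = n := Set.powersetCard.card_eq s
  have hcard : (insert i (s : Finset I)).card = n + 1 := by
    rw [Finset.card_insert_of_notMem hi, hs]
  -- the position of `i` in the increasing enumeration of `insert i s`
  obtain ⟨k, hk⟩ : ∃ k : Fin (n + 1), (k : ℕ) = ((s : Finset I).filter (· < i)).card :=
    ⟨⟨_, Nat.lt_succ_of_le ((Finset.card_filter_le _ _).trans hs.le)⟩, rfl⟩
  -- `(v i, v_{s₁}, …, v_{sₙ})` is the increasing family over `insert i s` permuted by the
  -- inverse of the cycle `(0 1 ⋯ k)`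
  have key : (Fin.cons (v i) (v ∘ ⇑((s : Finset I).orderEmbOfFin hs)) : Fin (n + 1) → M) =
      (v ∘ ⇑((insert i (s : Finset I)).orderEmbOfFin hcard)) ∘ ⇑(k.cycleRange.symm) := by
    funext j
    cases j using Fin.cases with
    | zero =>
      simp only [Fin.cons_zero, Function.comp_apply, Fin.cycleRange_symm_zero]
      rw [orderEmbOfFin_insert_apply_of_val_eq hcard k hk]
    | succ j =>
      simp only [Fin.cons_succ, Function.comp_apply, Fin.cycleRange_symm_succ]
      rw [orderEmbOfFin_insert_succAbove hs hcard k hk j]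
  rw [exteriorPower.ιMulti_family, exteriorPower.ιMulti_family, ιMul_ιMulti]
  change exteriorPower.ιMulti R (n + 1)
      (Fin.cons (v i) (v ∘ ⇑((s : Finset I).orderEmbOfFin hs))) =
    ((insertSign (s : Finset I) i : ℤˣ) : ℤ) •
      exteriorPower.ιMulti R (n + 1) (v ∘ ⇑((insert i (s : Finset I)).orderEmbOfFin hcard))
  rw [key, AlternatingMap.map_perm, Equiv.Perm.sign_symm, Fin.sign_cycleRange, hk,
    Units.smul_def]
  rfl

/-- The same identity for any `t : Set.powersetCard I (n + 1)` with underlying finset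
`insert i s`. [folklore] -/
theorem ιMul_ιMulti_family_of_coe_eq_insert {n : ℕ} (v : I → M) (s : Set.powersetCard I n)
    (i : I) (hi : i ∉ (s : Finset I)) (t : Set.powersetCard I (n + 1))
    (ht : (t : Finset I) = insert i (s : Finset I)) :
    ιMul n (v i) (exteriorPower.ιMulti_family R n v s) =
      ((insertSign (s : Finset I) i : ℤˣ) : ℤ) • exteriorPower.ιMulti_family R (n + 1) v t := by
  obtain ⟨t, ht'⟩ := t
  cases ht
  exact ιMul_ιMulti_family_of_not_mem v s i hi

/-- **Insertion of a repeated factor vanishes**: for `i ∈ s`,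
`v i ∧ (v_{s₁} ∧ ⋯ ∧ v_{sₙ}) = 0`. [folklore] -/
theorem ιMul_ιMulti_family_of_mem {n : ℕ} (v : I → M) (s : Set.powersetCard I n) (i : I)
    (hi : i ∈ (s : Finset I)) : ιMul n (v i) (exteriorPower.ιMulti_family R n v s) = 0 := by
  have hs : (s : Finset I).card = n := Set.powersetCard.card_eq s
  obtain ⟨j, hj⟩ : i ∈ Set.range ((s : Finset I).orderEmbOfFin hs) := by
    rw [Finset.range_orderEmbOfFin]; exact hi
  rw [exteriorPower.ιMulti_family, ιMul_ιMulti]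
  change exteriorPower.ιMulti R (n + 1)
    (Fin.cons (v i) (v ∘ ⇑((s : Finset I).orderEmbOfFin hs))) = 0
  refine AlternatingMap.map_eq_zero_of_eq _ _ (i := 0) (j := j.succ) ?_ (Fin.succ_ne_zero j).symm
  rw [Fin.cons_zero, Fin.cons_succ, Function.comp_apply, hj]

end Wedge

end Literature.AlgebraicGeometry.Crystalline
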